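/-
Copyright (c) 2026 the pub-hodgecm-mathlib formalisation cell (harness21).  Prover seat hodgecm-mathlib-K2E2-p12 (g5): Track B «K2-LIT», ENGINE E1,
h413 = stmt-HodgeConjecture-24833; (q10) «R7₃-SCALAR» FILE 3, brick (3-iv-a) «FINITE HEIGHT DICTIONARY» (assembly sub-brick; dealer K2E1-plan (g5) «=» 08:27Z ∕ 08:34Z).
-/
import Summits.HodgeConjecture.HodgeConjecture.Theorems.K2E1HeightBigCellLineFormulaU3           -- ★ (a2)₃: the finite height factor `h_f(X, b) = ∏ᶠ_w max(1, ‖X_w‖₊, ‖z(X, θ(0,b))_w‖₊)`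
import Summits.HodgeConjecture.HodgeConjecture.Theorems.K2E1IntertwiningLocalHeightU3            -- ★ (3-iii-a): the local height `Q_v` (its spelling)
import Literature.NumberTheory.Automorphic.QuadraticAdeleBaseChange                              -- ★ `quadraticFiniteAdeleMap`, `finiteAdeleToLocal_quadraticFiniteAdeleMap`, `eventually_forall_placesOver`
import Literature.NumberTheory.Automorphic.UnitaryGroupSymplecticCarriers                        -- ★ `finiteAdeleToLocal_conj`
import Literature.NumberTheory.Automorphic.GlobalHeckeTheoryGL2OfCenterInvariant                 -- ★ `norm_eq_coe_normAbs` (Mathlib's norm on `L_w` is `normAbs`)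
import Literature.NumberTheory.Rogawski1990.ExplicitFactorGlobalReciprocity                      -- ★ `finprod_eq_finprod_prod_placesOver` (regrouping `∏ᶠ_w = ∏ᶠ_v ∏_{w∣v}`)
import HarnessLib

/-!
# K2·E1 — `K2E1IntertwiningFiniteHeightDictionaryU3` ((q10) «R7₃-SCALAR» FILE 3, brick (3-iv-a)): THE FINITE HEIGHT FACTOR OF ★ (a2)₃ ALONG THE CM TRANSPORT IS THE EULER
# PRODUCT OF THE LOCAL HEIGHTS — `h_f((X_∞, Ψ^∞(a₀, a₁)), b) = ∏ᶠ_{v ∤ ∞ of L⁺} Q_v(a₀|_v, a₁|_v, b|_v)` and `((h_f^{−σ} : ℝ) : ℂ) = ∏ᶠ_v ((Q_v^{−σ} : ℝ) : ℂ)`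

Track B ∕ K2-LIT, crux h413 = `stmt-HodgeConjecture-24833`, route of record `HCCMUnconditional`; cell `hodgecm-mathlib`, squad K2, ENGINE E1 (campaign «EIS-RANK-ONE», R7 at
`N = 3`).  THEOREMS ONLY (no `def`, no instance, no notation, no `sorry`; default heartbeats); lane `--supports stmt-HodgeConjecture-24833 --as helper` (count-neutral).
CM pair `L ∕ L⁺`, `c` = complex conjugation, `δ ∈ L⁻ ∖ 0`; `Ψ^∞(a₀, a₁) = (a₀)_{𝔸_{L,f}} + (a₁)_{𝔸_{L,f}}·δ` (★ `quadraticFiniteAdeleMap` = ★ `K2E1FiniteAdeleBasisTransport`'s CM transport);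
`h_f(X, b) = ∏ᶠ_{w} max(1, ‖X_w‖₊, ‖z(X, θ(0,b))_w‖₊)` is ★ (a2)₃ `coe_borelHeight_weylLongU_heisChart_line_mul_eq_cm_three`'s finite factor VERBATIM; `Q_v` is ★ (3-iii-a)'s local height VERBATIM.
* §1 PLACE BLOCKS: `finiteAdeleToLocal_snd_eq_quadraticLocalEquiv` (`Ψ^∞(a₀,a₁)|_{w∣v} = Ψ_v(a₀|_v, a₁|_v)`), **`finiteAdeleToLocal_heisZ_snd_eq`**
  (`z((X_∞, Ψ^∞(a₀,a₁)), θ(0,b))|_{w∣v} = ι_v(b_v)·δ − ι_v(½)·Ψ_v·σΨ_v` — ★ `finiteAdeleToLocal_conj`, ★ `coe_traceZeroLine`; `algebraMap_inv_two_eq_toLocalRing`), place by place.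
* §2 NORMS: `coe_max_one_nnnorm_eq` (`‖·‖₊ = normAbs`, ★ `norm_eq_coe_normAbs`): the `w`-factor of `h_f` is the `w`-factor of `Q_v`, `v = w ∩ L⁺`.
* §3 SUPPORT: `hasFiniteMulSupport_heightFactor` (an adele is integral off finitely many places) and its regrouped twin.
* §4 **`coe_finprod_heightFactor_eq_finprod_localHeight`** (HEAD): `(h_f((X_∞, Ψ^∞(a₀,a₁)), b) : ℝ) = ∏ᶠ_v Q_v(a₀ v, a₁ v, b v)` (★ `finprod_eq_finprod_prod_placesOver`);
  **`ofReal_coe_finprod_heightFactor_rpow_neg_eq`**: `(((h_f : ℝ)^{−σ} : ℝ) : ℂ) = ∏ᶠ_v ((Q_v^{−σ} : ℝ) : ℂ)` — the integrand of ★ (3-iii-b2) `K2E1IntertwiningScalarEulerProductU3Finite`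
  at `x = (a₀, a₁, b)`.
HONEST LABEL: HC_CM is proved only modulo the 7 printed citations (2 remaining named inputs: hLiu418 = `stmt-HodgeConjecture-24832`, h413 = `stmt-HodgeConjecture-24833`) until rung 0
closes; this file asserts no named fact and closes no socket; count-neutral; unconditional adelic bookkeeping.

## References
* [CasselsFrohlichANT1967] J. W. S. Cassels, A. Fröhlich (eds.), *Algebraic Number Theory* (1967): Ch. II §11, §14.
* [Langlands1971] R. P. Langlands, *Euler Products* (1971): §3.
* [Garrett2018] P. Garrett, *Modern Analysis of Automorphic Forms by Example* (2018): §2.2.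
-/

set_option autoImplicit false
set_option linter.dupNamespace false -- the mandated namespace repeats `HodgeConjecture.HodgeConjecture`

noncomputable section

open NumberField IsDedekindDomain Filter
open scoped NNReal
open Literature.NumberTheory.Automorphic Literature.NumberTheory.Automorphic.UnitaryGroup Literature.NumberTheory.GaloisRepresentations
open Literature.NumberTheory.GaloisRepresentations.IsNonarchimedeanLocalField

namespace Summit.HodgeConjecture.HodgeConjecture.Cruxes.H413.K2E1IntertwiningFiniteHeightDictionaryU3

variable (L : Type) [Field L] [NumberField L] [IsCMField L] {δ : L} (hcδ : IsCMField.complexConj L δ = -δ) (hδ : δ ≠ 0)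
  (Xinf : InfiniteAdeleRing L) (a₀ a₁ b : FiniteAdeleRing (𝓞 ↥(maximalRealSubfield L)) ↥(maximalRealSubfield L))
  (v : HeightOneSpectrum (𝓞 ↥(maximalRealSubfield L)))

/-! ## §1 Place blocks: the finite adeles `Ψ^∞(a₀,a₁)` and `z(X, θ(0,b))` seen in `L ⊗ L⁺_v = ∏_{w∣v} L_w` -/

/-- **`Ψ^∞(a₀, a₁)|_{w∣v} = Ψ_v(a₀|_v, a₁|_v)`** (★ `finiteAdeleToLocal_quadraticFiniteAdeleMap` in the `quadraticLocalEquiv` spelling). [cite: CasselsFrohlichANT1967, Ch. II §14] -/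
theorem finiteAdeleToLocal_quadraticFiniteAdeleMap_eq_quadraticLocalEquiv :
    finiteAdeleToLocal L v (quadraticFiniteAdeleMap ↥(maximalRealSubfield L) L δ (a₀, a₁)) =
      quadraticLocalEquiv L v (IsCMField.complexConj L) hcδ hδ (a₀ v, a₁ v) := by
  rw [finiteAdeleToLocal_quadraticFiniteAdeleMap, quadraticLocalEquiv_apply, quadraticLocalMap_apply]

/-- Place by place: `Ψ^∞(a₀, a₁)_w = Ψ_v(a₀|_v, a₁|_v)_w` for `w ∣ v`. [cite: CasselsFrohlichANT1967, Ch. II §14] -/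
theorem quadraticFiniteAdeleMap_apply_placesOver (w : PlacesOver L v) :
    quadraticFiniteAdeleMap ↥(maximalRealSubfield L) L δ (a₀, a₁) w.1 = quadraticLocalEquiv L v (IsCMField.complexConj L) hcδ hδ (a₀ v, a₁ v) w := by
  rw [← finiteAdeleToLocal_apply L v _ w, finiteAdeleToLocal_quadraticFiniteAdeleMap_eq_quadraticLocalEquiv L hcδ hδ a₀ a₁ v]

omit [IsCMField L] in
/-- `ι_v(½)`: the principal `½ ∈ L` seen in `∏_{w∣v} L_w` is `ι_v` of `½ ∈ L⁺_v` (both are the inverse of `2` in each `L_w`). [folklore] -/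
theorem algebraMap_inv_two_eq_toLocalRing :
    algebraMap L (LocalRing L v) 2⁻¹ = toLocalRing L v (2⁻¹ : v.adicCompletion ↥(maximalRealSubfield L)) := by
  funext w
  rw [Pi.algebraMap_apply, toLocalRing_apply, map_inv₀, map_inv₀, map_ofNat, map_ofNat]

/-- **THE CENTRE COORDINATE IN THE PLACE BLOCK**: for `X = (X_∞, Ψ^∞(a₀, a₁))`,
`z(X, θ(0, b))|_{w∣v} = ι_v(b_v)·δ − ι_v(½)·(Ψ_v(a₀|_v,a₁|_v)·σΨ_v(a₀|_v,a₁|_v))` — the corner term of ★ (3-iii-a)'s `Q_v` (★ `coe_traceZeroLine`: `θ(t) = (t ⊗ 1)·δ`;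
★ `finiteAdeleToLocal_conj`: `(c ⊗ 1)|_{w∣v} = σ_v`). [cite: CasselsFrohlichANT1967, Ch. II §14] [cite: Garrett2018, §2.2] -/
theorem finiteAdeleToLocal_heisZ_snd_eq :
    finiteAdeleToLocal L v
        (heisZ (c := IsCMField.complexConj L) ((Xinf, quadraticFiniteAdeleMap ↥(maximalRealSubfield L) L δ (a₀, a₁)) : AdeleRing (𝓞 L) L)
          ((traceZeroLine ↥(maximalRealSubfield L) L (IsCMField.complexConj L) hcδ hδ
            ((0, b) : AdeleRing (𝓞 ↥(maximalRealSubfield L)) ↥(maximalRealSubfield L)) :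
              traceZeroAdele ↥(maximalRealSubfield L) L (IsCMField.complexConj L)) : AdeleRing (𝓞 L) L)).2 =
      toLocalRing L v (b v) * algebraMap L (LocalRing L v) δ -
        toLocalRing L v 2⁻¹ * (quadraticLocalEquiv L v (IsCMField.complexConj L) hcδ hδ (a₀ v, a₁ v) *
          conjLocal L (IsCMField.complexConj L) v (quadraticLocalEquiv L v (IsCMField.complexConj L) hcδ hδ (a₀ v, a₁ v))) := by
  -- the finite part of `z(X, θ(0,b)) = θ(0,b) − ½·X·c(X)`, componentwise in `𝔸_L = L_∞ × 𝔸_{L,f}` (definitional)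
  have h2 : (heisZ (c := IsCMField.complexConj L) ((Xinf, quadraticFiniteAdeleMap ↥(maximalRealSubfield L) L δ (a₀, a₁)) : AdeleRing (𝓞 L) L)
      ((traceZeroLine ↥(maximalRealSubfield L) L (IsCMField.complexConj L) hcδ hδ
        ((0, b) : AdeleRing (𝓞 ↥(maximalRealSubfield L)) ↥(maximalRealSubfield L)) :
          traceZeroAdele ↥(maximalRealSubfield L) L (IsCMField.complexConj L)) : AdeleRing (𝓞 L) L)).2 =
      FiniteAdeleRing.baseChange (𝓞 ↥(maximalRealSubfield L)) ↥(maximalRealSubfield L) L (𝓞 L) b * algebraMap L (FiniteAdeleRing (𝓞 L) L) δ -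
        algebraMap L (FiniteAdeleRing (𝓞 L) L) 2⁻¹ * (quadraticFiniteAdeleMap ↥(maximalRealSubfield L) L δ (a₀, a₁) *
          conjFiniteAdele ↥(maximalRealSubfield L) L (IsCMField.complexConj L) (quadraticFiniteAdeleMap ↥(maximalRealSubfield L) L δ (a₀, a₁))) := rfl
  rw [h2, map_sub, map_mul, map_mul, map_mul, finiteAdeleToLocal_conj, finiteAdeleToLocal_baseChange, finiteAdeleToLocal_algebraMap, finiteAdeleToLocal_algebraMap,
    algebraMap_inv_two_eq_toLocalRing, finiteAdeleToLocal_quadraticFiniteAdeleMap_eq_quadraticLocalEquiv L hcδ hδ a₀ a₁ v]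

/-- Place by place: `z(X, θ(0,b))_w` for `w ∣ v` is the `w`-component of the corner term. [cite: Garrett2018, §2.2] -/
theorem heisZ_snd_apply_placesOver (w : PlacesOver L v) :
    (heisZ (c := IsCMField.complexConj L) ((Xinf, quadraticFiniteAdeleMap ↥(maximalRealSubfield L) L δ (a₀, a₁)) : AdeleRing (𝓞 L) L)
        ((traceZeroLine ↥(maximalRealSubfield L) L (IsCMField.complexConj L) hcδ hδ
          ((0, b) : AdeleRing (𝓞 ↥(maximalRealSubfield L)) ↥(maximalRealSubfield L)) :
            traceZeroAdele ↥(maximalRealSubfield L) L (IsCMField.complexConj L)) : AdeleRing (𝓞 L) L)).2 w.1 =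
      (toLocalRing L v (b v) * algebraMap L (LocalRing L v) δ -
        toLocalRing L v 2⁻¹ * (quadraticLocalEquiv L v (IsCMField.complexConj L) hcδ hδ (a₀ v, a₁ v) *
          conjLocal L (IsCMField.complexConj L) v (quadraticLocalEquiv L v (IsCMField.complexConj L) hcδ hδ (a₀ v, a₁ v)))) w := by
  rw [← finiteAdeleToLocal_apply L v _ w, finiteAdeleToLocal_heisZ_snd_eq L hcδ hδ Xinf a₀ a₁ b v]

/-! ## §2 Norms: the `w`-factor of `h_f` is the `w`-factor of `Q_v` -/

/-- **`max(1, ‖X_w‖₊, ‖z_w‖₊) = max(1, |Ψ_v(a₀,a₁)_w|, |corner_w|)`** in `ℝ` (`‖·‖ = normAbs` on `L_w`, ★ `norm_eq_coe_normAbs`). [folklore] -/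
theorem coe_max_one_nnnorm_eq (w : PlacesOver L v) :
    ((max 1 (max ‖((Xinf, quadraticFiniteAdeleMap ↥(maximalRealSubfield L) L δ (a₀, a₁)) : AdeleRing (𝓞 L) L).2 w.1‖₊
        ‖(heisZ (c := IsCMField.complexConj L) ((Xinf, quadraticFiniteAdeleMap ↥(maximalRealSubfield L) L δ (a₀, a₁)) : AdeleRing (𝓞 L) L)
          ((traceZeroLine ↥(maximalRealSubfield L) L (IsCMField.complexConj L) hcδ hδ
            ((0, b) : AdeleRing (𝓞 ↥(maximalRealSubfield L)) ↥(maximalRealSubfield L)) :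
              traceZeroAdele ↥(maximalRealSubfield L) L (IsCMField.complexConj L)) : AdeleRing (𝓞 L) L)).2 w.1‖₊) : ℝ≥0) : ℝ) =
      max 1 (max ((normAbs (w.1.adicCompletion L) (quadraticLocalEquiv L v (IsCMField.complexConj L) hcδ hδ (a₀ v, a₁ v) w) : ℝ≥0) : ℝ)
        ((normAbs (w.1.adicCompletion L) ((toLocalRing L v (b v) * algebraMap L (LocalRing L v) δ -
          toLocalRing L v 2⁻¹ * (quadraticLocalEquiv L v (IsCMField.complexConj L) hcδ hδ (a₀ v, a₁ v) *
            conjLocal L (IsCMField.complexConj L) v (quadraticLocalEquiv L v (IsCMField.complexConj L) hcδ hδ (a₀ v, a₁ v)))) w) : ℝ≥0) : ℝ)) := by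
  rw [heisZ_snd_apply_placesOver L hcδ hδ Xinf a₀ a₁ b v w, show ((Xinf, quadraticFiniteAdeleMap ↥(maximalRealSubfield L) L δ (a₀, a₁)) : AdeleRing (𝓞 L) L).2 w.1 =
      quadraticFiniteAdeleMap ↥(maximalRealSubfield L) L δ (a₀, a₁) w.1 from rfl, quadraticFiniteAdeleMap_apply_placesOver L hcδ hδ a₀ a₁ v w,
    NNReal.coe_max, NNReal.coe_max, NNReal.coe_one, coe_nnnorm, coe_nnnorm, norm_eq_coe_normAbs, norm_eq_coe_normAbs]

/-! ## §3 Support: an adele is integral off finitely many places -/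

omit [IsCMField L] in
/-- **The factors of `h_f` are `1` off a finite set of places of `L`** (a finite adele is integral at almost every place; `‖·‖ ≤ 1` on `𝒪_w`). [cite: CasselsFrohlichANT1967, Ch. II §14] -/
theorem eventually_heightFactor_eq_one (X : AdeleRing (𝓞 L) L) (Z : AdeleRing (𝓞 L) L) :
    ∀ᶠ w : HeightOneSpectrum (𝓞 L) in cofinite, max 1 (max ‖X.2 w‖₊ ‖Z.2 w‖₊) = 1 := by
  filter_upwards [X.2.2, Z.2.2] with w hX hZ
  have h1 : ∀ {y : w.adicCompletion L}, y ∈ w.adicCompletionIntegers L → ‖y‖₊ ≤ 1 := fun {y} hy => by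
    rw [← NNReal.coe_le_coe, coe_nnnorm, norm_eq_coe_normAbs, NNReal.coe_le_coe]
    have hm : y ∈ primePowBall (w.adicCompletion L) 0 := (mem_primePowBall_zero_iff y).2 hy
    exact normAbs_le_one_iff.2 (LocalFieldHaar.mem_primePowBall_zero_iff.1 hm)
  exact max_eq_left (max_le (h1 hX) (h1 hZ))

omit [IsCMField L] in
/-- The factors of `h_f` have finite multiplicative support. [folklore] -/
theorem hasFiniteMulSupport_heightFactor (X : AdeleRing (𝓞 L) L) (Z : AdeleRing (𝓞 L) L) :
    (Function.mulSupport fun w : HeightOneSpectrum (𝓞 L) => max 1 (max ‖X.2 w‖₊ ‖Z.2 w‖₊)).Finite := by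
  have h := eventually_heightFactor_eq_one L X Z
  rw [eventually_cofinite] at h
  exact h.subset fun w hw => hw

omit [IsCMField L] in
/-- The same in `ℝ`. [folklore] -/
theorem hasFiniteMulSupport_coe_heightFactor (X : AdeleRing (𝓞 L) L) (Z : AdeleRing (𝓞 L) L) :
    (Function.mulSupport fun w : HeightOneSpectrum (𝓞 L) => ((max 1 (max ‖X.2 w‖₊ ‖Z.2 w‖₊) : ℝ≥0) : ℝ)).Finite := by
  refine (hasFiniteMulSupport_heightFactor L X Z).subset fun w hw => ?_
  rw [Function.mem_mulSupport] at hw ⊢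
  exact fun h => hw (by rw [h, NNReal.coe_one])

omit [IsCMField L] in
/-- **The regrouped factors `∏_{w∣v}` are `1` off a finite set of places of `L⁺`** (★ `eventually_forall_placesOver`). [cite: CasselsFrohlichANT1967, Ch. II §11] -/
theorem hasFiniteMulSupport_prod_placesOver_coe_heightFactor (X : AdeleRing (𝓞 L) L) (Z : AdeleRing (𝓞 L) L) :
    (Function.mulSupport fun v : HeightOneSpectrum (𝓞 ↥(maximalRealSubfield L)) =>
      ∏ w : PlacesOver L v, ((max 1 (max ‖X.2 w.1‖₊ ‖Z.2 w.1‖₊) : ℝ≥0) : ℝ)).Finite := by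
  have h := eventually_forall_placesOver (F := ↥(maximalRealSubfield L)) (E := L) (eventually_heightFactor_eq_one L X Z)
  rw [eventually_cofinite] at h
  refine h.subset fun v hv => ?_
  intro hall
  exact hv (Finset.prod_eq_one fun w _ => by rw [hall w, NNReal.coe_one])

/-! ## §4 HEAD: the finite height factor is the Euler product of the local heights -/

/-- **`h_f((X_∞, Ψ^∞(a₀,a₁)), b) = ∏ᶠ_{v} Q_v(a₀|_v, a₁|_v, b|_v)`** in `ℝ`: ★ (a2)₃'s finite factor along the CM transport is the finitely supported product over the
finite places `v` of `L⁺` of ★ (3-iii-a)'s local heights (regrouping ★ `finprod_eq_finprod_prod_placesOver`; §1–§3). [cite: Langlands1971, §3] [cite: CasselsFrohlichANT1967, Ch. II §11] -/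
theorem coe_finprod_heightFactor_eq_finprod_localHeight :
    ((∏ᶠ w : HeightOneSpectrum (𝓞 L), max 1 (max ‖((Xinf, quadraticFiniteAdeleMap ↥(maximalRealSubfield L) L δ (a₀, a₁)) : AdeleRing (𝓞 L) L).2 w‖₊
        ‖(heisZ (c := IsCMField.complexConj L) ((Xinf, quadraticFiniteAdeleMap ↥(maximalRealSubfield L) L δ (a₀, a₁)) : AdeleRing (𝓞 L) L)
          ((traceZeroLine ↥(maximalRealSubfield L) L (IsCMField.complexConj L) hcδ hδ
            ((0, b) : AdeleRing (𝓞 ↥(maximalRealSubfield L)) ↥(maximalRealSubfield L)) :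
              traceZeroAdele ↥(maximalRealSubfield L) L (IsCMField.complexConj L)) : AdeleRing (𝓞 L) L)).2 w‖₊) : ℝ≥0) : ℝ) =
      ∏ᶠ v : HeightOneSpectrum (𝓞 ↥(maximalRealSubfield L)),
        ∏ w' : PlacesOver L v, max 1 (max ((normAbs (w'.1.adicCompletion L) (quadraticLocalEquiv L v (IsCMField.complexConj L) hcδ hδ (a₀ v, a₁ v) w') : ℝ≥0) : ℝ)
          ((normAbs (w'.1.adicCompletion L) ((toLocalRing L v (b v) * algebraMap L (LocalRing L v) δ -
            toLocalRing L v 2⁻¹ * (quadraticLocalEquiv L v (IsCMField.complexConj L) hcδ hδ (a₀ v, a₁ v) *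
              conjLocal L (IsCMField.complexConj L) v (quadraticLocalEquiv L v (IsCMField.complexConj L) hcδ hδ (a₀ v, a₁ v)))) w') : ℝ≥0) : ℝ)) := by
  refine Eq.trans (map_finprod NNReal.toRealHom (hasFiniteMulSupport_heightFactor L _ _)) ?_
  rw [NNReal.coe_toRealHom,
    Literature.NumberTheory.Rogawski1990.finprod_eq_finprod_prod_placesOver ↥(maximalRealSubfield L) _ (hasFiniteMulSupport_coe_heightFactor L _ _)]
  exact finprod_congr fun v => Finset.prod_congr rfl fun w _ => coe_max_one_nnnorm_eq L hcδ hδ Xinf a₀ a₁ b v w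

/-- **`(((h_f : ℝ)^{−σ} : ℝ) : ℂ) = ∏ᶠ_v ((Q_v^{−σ} : ℝ) : ℂ)`** — the `ℂ`-valued integrand of ★ (3-iii-b2) `K2E1IntertwiningScalarEulerProductU3Finite` at `x = (a₀, a₁, b)` IS the finite height factor
of ★ (a2)₃ to the power `−σ` (finite supports, `Real.finsetProd_rpow`, `Complex.ofReal_prod`). [cite: Langlands1971, §3] -/
theorem ofReal_coe_finprod_heightFactor_rpow_neg_eq (σ : ℝ) :
    ((((∏ᶠ w : HeightOneSpectrum (𝓞 L), max 1 (max ‖((Xinf, quadraticFiniteAdeleMap ↥(maximalRealSubfield L) L δ (a₀, a₁)) : AdeleRing (𝓞 L) L).2 w‖₊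
        ‖(heisZ (c := IsCMField.complexConj L) ((Xinf, quadraticFiniteAdeleMap ↥(maximalRealSubfield L) L δ (a₀, a₁)) : AdeleRing (𝓞 L) L)
          ((traceZeroLine ↥(maximalRealSubfield L) L (IsCMField.complexConj L) hcδ hδ
            ((0, b) : AdeleRing (𝓞 ↥(maximalRealSubfield L)) ↥(maximalRealSubfield L)) :
              traceZeroAdele ↥(maximalRealSubfield L) L (IsCMField.complexConj L)) : AdeleRing (𝓞 L) L)).2 w‖₊) : ℝ≥0) : ℝ) ^ (-σ) : ℝ) : ℂ) =
      ∏ᶠ v : HeightOneSpectrum (𝓞 ↥(maximalRealSubfield L)),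
        (((∏ w' : PlacesOver L v, max 1 (max ((normAbs (w'.1.adicCompletion L) (quadraticLocalEquiv L v (IsCMField.complexConj L) hcδ hδ (a₀ v, a₁ v) w') : ℝ≥0) : ℝ)
          ((normAbs (w'.1.adicCompletion L) ((toLocalRing L v (b v) * algebraMap L (LocalRing L v) δ -
            toLocalRing L v 2⁻¹ * (quadraticLocalEquiv L v (IsCMField.complexConj L) hcδ hδ (a₀ v, a₁ v) *
              conjLocal L (IsCMField.complexConj L) v (quadraticLocalEquiv L v (IsCMField.complexConj L) hcδ hδ (a₀ v, a₁ v)))) w') : ℝ≥0) : ℝ))) ^ (-σ) : ℝ) : ℂ) := by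
  rw [coe_finprod_heightFactor_eq_finprod_localHeight L hcδ hδ Xinf a₀ a₁ b]
  -- the common finite support `T`
  have hfin := hasFiniteMulSupport_prod_placesOver_coe_heightFactor L
    ((Xinf, quadraticFiniteAdeleMap ↥(maximalRealSubfield L) L δ (a₀, a₁)) : AdeleRing (𝓞 L) L)
    (heisZ (c := IsCMField.complexConj L) ((Xinf, quadraticFiniteAdeleMap ↥(maximalRealSubfield L) L δ (a₀, a₁)) : AdeleRing (𝓞 L) L)
      ((traceZeroLine ↥(maximalRealSubfield L) L (IsCMField.complexConj L) hcδ hδ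
        ((0, b) : AdeleRing (𝓞 ↥(maximalRealSubfield L)) ↥(maximalRealSubfield L)) :
          traceZeroAdele ↥(maximalRealSubfield L) L (IsCMField.complexConj L)) : AdeleRing (𝓞 L) L))
  have hpt : ∀ v : HeightOneSpectrum (𝓞 ↥(maximalRealSubfield L)),
      (∏ w : PlacesOver L v, ((max 1 (max ‖((Xinf, quadraticFiniteAdeleMap ↥(maximalRealSubfield L) L δ (a₀, a₁)) : AdeleRing (𝓞 L) L).2 w.1‖₊
        ‖(heisZ (c := IsCMField.complexConj L) ((Xinf, quadraticFiniteAdeleMap ↥(maximalRealSubfield L) L δ (a₀, a₁)) : AdeleRing (𝓞 L) L)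
          ((traceZeroLine ↥(maximalRealSubfield L) L (IsCMField.complexConj L) hcδ hδ
            ((0, b) : AdeleRing (𝓞 ↥(maximalRealSubfield L)) ↥(maximalRealSubfield L)) :
              traceZeroAdele ↥(maximalRealSubfield L) L (IsCMField.complexConj L)) : AdeleRing (𝓞 L) L)).2 w.1‖₊) : ℝ≥0) : ℝ)) =
      ∏ w' : PlacesOver L v, max 1 (max ((normAbs (w'.1.adicCompletion L) (quadraticLocalEquiv L v (IsCMField.complexConj L) hcδ hδ (a₀ v, a₁ v) w') : ℝ≥0) : ℝ)
          ((normAbs (w'.1.adicCompletion L) ((toLocalRing L v (b v) * algebraMap L (LocalRing L v) δ -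
            toLocalRing L v 2⁻¹ * (quadraticLocalEquiv L v (IsCMField.complexConj L) hcδ hδ (a₀ v, a₁ v) *
              conjLocal L (IsCMField.complexConj L) v (quadraticLocalEquiv L v (IsCMField.complexConj L) hcδ hδ (a₀ v, a₁ v)))) w') : ℝ≥0) : ℝ)) :=
    fun v => Finset.prod_congr rfl fun w _ => coe_max_one_nnnorm_eq L hcδ hδ Xinf a₀ a₁ b v w
  simp_rw [hpt] at hfin
  set T := hfin.toFinset with hT
  have hsub : (Function.mulSupport fun v : HeightOneSpectrum (𝓞 ↥(maximalRealSubfield L)) =>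
      ∏ w' : PlacesOver L v, max 1 (max ((normAbs (w'.1.adicCompletion L) (quadraticLocalEquiv L v (IsCMField.complexConj L) hcδ hδ (a₀ v, a₁ v) w') : ℝ≥0) : ℝ)
          ((normAbs (w'.1.adicCompletion L) ((toLocalRing L v (b v) * algebraMap L (LocalRing L v) δ -
            toLocalRing L v 2⁻¹ * (quadraticLocalEquiv L v (IsCMField.complexConj L) hcδ hδ (a₀ v, a₁ v) *
              conjLocal L (IsCMField.complexConj L) v (quadraticLocalEquiv L v (IsCMField.complexConj L) hcδ hδ (a₀ v, a₁ v)))) w') : ℝ≥0) : ℝ))) ⊆ ↑T := by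
    rw [hT, Set.Finite.coe_toFinset]
  have hsub' : (Function.mulSupport fun v : HeightOneSpectrum (𝓞 ↥(maximalRealSubfield L)) =>
      (((∏ w' : PlacesOver L v, max 1 (max ((normAbs (w'.1.adicCompletion L) (quadraticLocalEquiv L v (IsCMField.complexConj L) hcδ hδ (a₀ v, a₁ v) w') : ℝ≥0) : ℝ)
          ((normAbs (w'.1.adicCompletion L) ((toLocalRing L v (b v) * algebraMap L (LocalRing L v) δ -
            toLocalRing L v 2⁻¹ * (quadraticLocalEquiv L v (IsCMField.complexConj L) hcδ hδ (a₀ v, a₁ v) *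
              conjLocal L (IsCMField.complexConj L) v (quadraticLocalEquiv L v (IsCMField.complexConj L) hcδ hδ (a₀ v, a₁ v)))) w') : ℝ≥0) : ℝ))) ^ (-σ) : ℝ) : ℂ)) ⊆ ↑T := by
    intro v hv
    by_contra hvT
    have h1 := Function.notMem_mulSupport.1 (fun h => hvT (hsub h))
    exact hv (by simp only [h1, Real.one_rpow, Complex.ofReal_one])
  rw [finprod_eq_prod_of_mulSupport_subset _ hsub, finprod_eq_prod_of_mulSupport_subset _ hsub', ← Complex.ofReal_prod,
    Real.finsetProd_rpow _ _ (fun v _ => Finset.prod_nonneg fun w _ => le_trans zero_le_one (le_max_left _ _))]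

end Summit.HodgeConjecture.HodgeConjecture.Cruxes.H413.K2E1IntertwiningFiniteHeightDictionaryU3

end
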